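import Mathlib
import HarnessLib
import Literature.AlgebraicGeometry.Ramification.InertiaNormalSylow
import Literature.AlgebraicGeometry.Resolution.ResolutionOfSingularities
import Literature.AlgebraicGeometry.Resolution.Blowups
import Literature.AlgebraicGeometry.Resolution.BlowupsExistence
import Literature.AlgebraicGeometry.Resolution.BlowupsEquivariant
import Literature.AlgebraicGeometry.Resolution.BlowupsIntegral
import Literature.AlgebraicGeometry.Resolution.BlowupsProperProofs
import Literature.AlgebraicGeometry.Resolution.BlowupRegularPoints
import Literature.AlgebraicGeometry.Resolution.QuasiExcellentSchemes
import Summits.ResolutionOfSingularities.ResolutionOfSingularities.Theorems.WildQuotientsWildQuotientResolutionStubBorelCore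
import Summits.ResolutionOfSingularities.ResolutionOfSingularities.Theorems.WildQuotientsWildQuotientResolutionStubInertiaLocus
import Summits.ResolutionOfSingularities.ResolutionOfSingularities.Theorems.WildQuotientsWildQuotientResolutionStubNpcCentre
import Summits.ResolutionOfSingularities.ResolutionOfSingularities.Theorems.WildQuotientsWildQuotientResolutionStubPointBlowupStalkData
import Summits.ResolutionOfSingularities.ResolutionOfSingularities.Theorems.WildQuotientsWildQuotientResolutionStubStableAffineCoverBlowup
import Summits.ResolutionOfSingularities.ResolutionOfSingularities.Theorems.WildQuotientsWildQuotientResolutionStubInertiaLe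
import Summits.ResolutionOfSingularities.ResolutionOfSingularities.Theorems.WildQuotientsWildQuotientResolutionPhaseZeroDimOne
import Summits.ResolutionOfSingularities.ResolutionOfSingularities.Theorems.WildQuotientsWildQuotientResolutionGluedSplitNormal

/-!
# Phase 0 on surfaces is ONE equivariant blow-up (crux `WildQuotients.WildQuotientResolution`, line `Sketch`)

Crux stmt-ResolutionOfSingularities-15640 (`WildQuotientResolution`: every Galois-type quotient
`X₁` of a REGULAR integral `X′` by a finite group in characteristic `p` has a resolution), line
`Sketch` (card `p-closure-sylow-separation`), lead c4. The line splits the crux as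
PhaseZeroModel ∧ PClosedWQ (glue landed: `GluedSplit`, `GluedSplitDim`, `GluedSplitNormal`), where
PhaseZeroModel asks for a `G`-equivariant proper birational REGULAR model `X♯ → X′` on which every
inertia group `I_x` (AS2011 2.4) is p-closed (has a normal Sylow `p`-subgroup) and which carries a
`G`-stable affine cover. Leads c1–c3 recorded PhaseZeroModel as open-adjacent in all dimensions
and, on surfaces, as needing an infinite tower of point blow-ups closed off by König + Abhyankar's
lemma + the ramification theory of Krull valuations. This file PROVES the surface case with a
single blow-up:

**Theorem** (`phaseZero_dimLE_two`). For the crux data with `G` acting faithfully and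
`dim X′ ≤ 2`, the blow-up `X♯ = Bl_Z X′` of the finite reduced `G`-stable set `Z = NPC(X′)` of
(closed) points with non-p-closed inertia, with its lifted action, is a PhaseZeroModel.

The point is the *Borel argument* (`BorelCore.stub_borelCore`): at `x ∈ X♯` over `z ∈ Z` the
blow-up makes `𝔪_z 𝒪_{X♯,x} = (t)` invertible, so `𝔪_z/𝔪_z² → 𝔪_z𝒪_{X♯,x} ⊗ κ(x)` (a line) is
`I_x`-equivariant with `I_x` acting on the line through a character (inertia is residue-trivial);
its kernel is a COMMON STABLE LINE of the `2`-dimensional cotangent representation of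
`I_x ≤ I_z`, so the image of `I_x` in `GL₂(κ)` lies in a Borel subgroup — unipotent `p`-group by
`p′`-torus — hence is p-closed; the kernel of `I_z → GL(𝔪/𝔪²)` is a `p`-group (tame automorphisms
trivial on `κ ⊕ 𝔪/𝔪²` are trivial, `TameAutomorphismCotangent`, plus faithfulness on stalks), and
p-group-by-p-closed is p-closed. The remaining inputs: `InertiaLocus.stub_isClosed_inertiaLocus` +
`NpcCentre.stub_npcCentre` (the centre is a finite closed `G`-stable set of closed points with
`2`-dimensional local rings — generic inertia is trivial, DVR inertia is p-closed),
`PointBlowupStalkData.stub_pointBlowupStalkData` (the local package at a point over the centre),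
`StableAffineCoverBlowup.stub_stableAffineCoverBlowup` (Mumford's cover clause survives the
blow-up), and the tree's blow-up library (`exists_isBlowup`, `IsBlowup.liftAction`,
`IsBlowup.isRegularLocalRing_stalk_of_finite`, `IsBlowup.isIso_compl`, `IsBlowup.isIntegral`,
`IsBlowup.isProper`, `IsBlowup.isBirational'`).

**Corollary** (`wildQuotientResolution_dimLE_two_of_pClosedWQNormal`): in dimension `≤ 2` the
crux IS its p-closed sub-problem — WQ_{≤2} ⇐ PClosedWQNormal_{≤2} unconditionally (glue
`GluedSplitNormal.wildQuotientResolution_dimLE_of_phaseZero_of_pClosedWQNormal 2`). So the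
promoted PhaseZeroModel is open only from `dim X′ = 3` (registered `stub_phaseZeroHighDim`).

* `hasNormalSylow_of_le` — p-closedness passes to smaller subgroups of the ambient group.
* `charP_residueField` — residue fields of a scheme over a field of characteristic `p`.
* `phaseZero_dimLE_two` — the theorem.
* `wildQuotientResolution_dimLE_two_of_pClosedWQNormal` — the corollary.
-/

-- single-problem summit: the doubled namespace component `ResolutionOfSingularities` is forced
set_option linter.dupNamespace false

noncomputable section

open CategoryTheory AlgebraicGeometry TopologicalSpace IsLocalRing
open Literature.AlgebraicGeometry.Resolution Literature.AlgebraicGeometry.Ramification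

namespace Summit.ResolutionOfSingularities.ResolutionOfSingularities.Theorems.WildQuotientResolution.PhaseZeroDimTwo

/-- p-closedness passes to smaller subgroups of the ambient group: if `H ≤ K ≤ G` and `K` has a
normal Sylow `p`-subgroup then so has `H` (`H ≃* H.subgroupOf K`, `HasNormalSylow.subgroup`,
`HasNormalSylow.of_surjective`). [folklore] -/
theorem hasNormalSylow_of_le {p : ℕ} [Fact p.Prime] {G : Type*} [Group G] [Finite G]
    {H K : Subgroup G} (hHK : H ≤ K) (hK : HasNormalSylow p K) : HasNormalSylow p H :=
  (hK.subgroup (H.subgroupOf K)).of_surjective (Subgroup.subgroupOfEquivOfLe hHK).toMonoidHom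
    (Subgroup.subgroupOfEquivOfLe hHK).surjective

/-- Residue fields of the local rings of a scheme over a field `k` of characteristic `p` have
characteristic `p` (`k → Γ(X, ⊤) → 𝒪_{X,x} → κ(x)` is a ring map out of a field). [folklore] -/
theorem charP_residueField (p : ℕ) {k : Type} [Field k] [CharP k p] {X : Scheme.{0}}
    (g : X ⟶ Spec (.of k)) (x : X) : CharP (ResidueField (X.presheaf.stalk x)) p :=
  (((IsLocalRing.residue (X.presheaf.stalk x)).comp ((X.presheaf.germ ⊤ x trivial).hom.comp
    ((g.appTop).hom.comp (Scheme.ΓSpecIso (.of k)).inv.hom))).charP_iff_charP p).mp inferInstance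

/-- **PhaseZeroModel in dimension `≤ 2` — Phase 0 on a regular `G`-surface is ONE equivariant
blow-up** (line `Sketch`, lead c4: the `dim X′ ≤ 2` case of the registered stub `stub_phaseZero`, assembled from the
five classical stubs of skeleton v6 and the tree's blow-up library). For the crux data with `G` acting FAITHFULLY on the regular integral `X′` of dimension
`≤ 2`: let `Z = NPC(X′)` be the finite closed `G`-stable set of closed points with non-p-closed
inertia (`stub_isClosed_inertiaLocus`, `stub_npcCentre`); blow `X′` up along the reduced ideal
`𝓘_Z` (`exists_isBlowup`) and lift the action (`IsBlowup.liftAction`,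
`vanishingIdeal_comap_eq_of_action`). The model `π : X♯ → X′` is proper (`IsBlowup.isProper`),
birational and integral (`IsBlowup.isBirational'`, `IsBlowup.isIntegral`: `𝓘_Z ≠ 0` as the generic
point has trivial inertia), regular (over `Z` by `IsBlowup.isRegularLocalRing_stalk_of_finite`, off
`Z` because `π` is an isomorphism there, `IsBlowup.isIso_compl`), every inertia group is p-closed
(over `Z`: `stub_pointBlowupStalkData` feeds `stub_borelCore` — embedding dimension
`dim 𝒪_{X′,z} = 2`; off `Z`: inertia only shrinks, `InertiaLe.stub_inertia_le`), and `X♯` has a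
`G`-stable affine cover (`stub_stableAffineCoverBlowup`). [folklore — the Borel argument] -/
theorem phaseZero_dimLE_two (p : ℕ) (hp : p.Prime) (k : Type) [Field k] [CharP k p]
    (X' X₁ : Scheme.{0}) (f : X₁ ⟶ Spec (.of k)) (q : X' ⟶ X₁) (G : Type) [Group G] [Finite G]
    (ρ : G →* Aut X') (hfaith : Function.Injective ρ)
    [IsSeparated f] [LocallyOfFiniteType f] [QuasiCompact f] [IsIntegral X']
    (hreg : Scheme.IsRegular X') [IsFinite q] (hρ : ∀ g : G, (ρ g).hom ≫ q = q)
    (hdim : topologicalKrullDim X' ≤ 2) :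
    ∃ (Xs : Scheme.{0}) (π : Xs ⟶ X') (ρs : G →* Aut Xs), IsProper π ∧ IsBirational π ∧
      IsIntegral Xs ∧ Scheme.IsRegular Xs ∧ (∀ g : G, (ρs g).hom ≫ π = π ≫ (ρ g).hom) ∧
      (∀ x : Xs, HasNormalSylow p (inertiaSubgroup ρs x)) ∧
      ∀ x : Xs, ∃ U : Xs.Opens, IsAffineOpen U ∧ x ∈ U ∧ ∀ g : G, (ρs g).hom ⁻¹ᵁ U = U := by
  haveI : Fact p.Prime := ⟨hp⟩
  -- `X′` is Noetherian and separated (finite over the separated finite-type `X₁/k`)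
  haveI : IsLocallyNoetherian X' := LocallyOfFiniteType.isLocallyNoetherian (q ≫ f)
  haveI : CompactSpace X' := QuasiCompact.compactSpace_of_compactSpace (q ≫ f)
  haveI : X'.IsSeparated := Scheme.isSeparated_of_isSeparated_over (q ≫ f)
  -- the centre `Z = NPC(X′)`
  have hcl : ∀ h : G, IsClosed {x : X' | h ∈ inertiaSubgroup ρ x} := fun h =>
    InertiaLocus.stub_isClosed_inertiaLocus q ρ hρ h
  obtain ⟨Z, hZiff, hZc, hZf, hZpt, hZstab, hZdim⟩ :=
    NpcCentre.stub_npcCentre p f q ρ hfaith hρ hreg hdim hcl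
  -- the blow-up and the lifted action
  obtain ⟨Xs, π, hπ⟩ := exists_isBlowup X' (Scheme.IdealSheafData.vanishingIdeal ⟨Z, hZc⟩)
  have hJG : ∀ g : G, (Scheme.IdealSheafData.vanishingIdeal (⟨Z, hZc⟩ : Closeds X')).comap
      (ρ g).hom = Scheme.IdealSheafData.vanishingIdeal ⟨Z, hZc⟩ :=
    vanishingIdeal_comap_eq_of_action ρ ⟨Z, hZc⟩ hZstab
  let ρs : G →* Aut Xs := hπ.liftAction ρ hJG
  have hequiv : ∀ g : G, (ρs g).hom ≫ π = π ≫ (ρ g).hom := hπ.liftAction_hom_comp ρ hJG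
  -- the generic point is not in `Z`, so `𝓘_Z ≠ 0`
  have hη : genericPoint X' ∉ Z := by
    rw [hZiff, not_not, PhaseZeroDimOne.inertiaSubgroup_genericPoint_eq_bot
      q ρ hρ hfaith]
    exact HasNormalSylow.of_isPGroup IsPGroup.of_bot
  have hJne : Scheme.IdealSheafData.vanishingIdeal (⟨Z, hZc⟩ : Closeds X') ≠ ⊥ := by
    intro h
    have hsupp : Z = Set.univ := by
      have := congrArg (fun I : X'.IdealSheafData => ((I.support : Closeds X') : Set X')) h
      simpa using this
    exact hη (hsupp ▸ Set.mem_univ _)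
  haveI hXs : IsIntegral Xs := hπ.isIntegral hJne
  haveI hπp : IsProper π := hπ.isProper
  have hbir : IsBirational π := hπ.isBirational' hJne
  -- regularity of `X♯`
  have hRo : IsOpen (Scheme.regularLocus X') := by
    have : Scheme.regularLocus X' = Set.univ := Set.eq_univ_of_forall fun x => hreg x
    rw [this]
    exact isOpen_univ
  have hXsreg : Scheme.IsRegular Xs := by
    intro x
    by_cases hx : π.base x ∈ Z
    · exact IsBlowup.isRegularLocalRing_stalk_of_finite hRo hZc hZf hZpt (fun z _ => hreg z) hπ hx
    · set W₀ : X'.Opens := ⟨((Scheme.IdealSheafData.vanishingIdeal (⟨Z, hZc⟩ : Closeds X')).support :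
          Set X')ᶜ, (Scheme.IdealSheafData.vanishingIdeal (⟨Z, hZc⟩ : Closeds X')).support.isClosed.isOpen_compl⟩
        with hW₀
      haveI : IsIso (π ∣_ W₀) := hπ.isIso_compl
      have hxW : x ∈ π ⁻¹ᵁ W₀ := by
        change π.base x ∈ ((Scheme.IdealSheafData.vanishingIdeal (⟨Z, hZc⟩ : Closeds X')).support :
          Set X')ᶜ
        rw [Scheme.IdealSheafData.coe_support_vanishingIdeal]
        exact hx
      have hregW : Scheme.IsRegular (↑(π ⁻¹ᵁ W₀) : Scheme.{0}) :=
        Scheme.IsRegular.of_isOpenImmersion (π ∣_ W₀ ≫ W₀.ι) hreg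
      haveI := hregW ⟨x, hxW⟩
      exact IsRegularLocalRing.of_ringEquiv
        (asIso ((π ⁻¹ᵁ W₀).ι.stalkMap ⟨x, hxW⟩)).commRingCatIsoToRingEquiv.symm
  refine ⟨Xs, π, ρs, hπp, hbir, hXs, hXsreg, hequiv, fun x => ?_, fun x => ?_⟩
  · -- inertia groups are p-closed
    by_cases hx : π.base x ∈ Z
    · obtain ⟨τ, τ₁, t, hτ, hcomp, hres, ht, hgen, hι⟩ :=
        PointBlowupStalkData.stub_pointBlowupStalkData q ρ hfaith hρ hZc hZf hZpt hπ ρs hequiv x hx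
      haveI := hreg (π.base x)
      haveI : CharP (ResidueField (X'.presheaf.stalk (π.base x))) p :=
        charP_residueField p (q ≫ f) (π.base x)
      haveI : CharP (ResidueField (Xs.presheaf.stalk x)) p := charP_residueField p (π ≫ q ≫ f) x
      have hfin : Module.finrank (ResidueField (X'.presheaf.stalk (π.base x)))
          (CotangentSpace (X'.presheaf.stalk (π.base x))) ≤ 2 := by
        have h2 := (IsRegularLocalRing.iff_finrank_cotangentSpace (X'.presheaf.stalk (π.base x))).mp
          inferInstance
        rw [hZdim _ hx] at h2
        have h2' : (Module.finrank (ResidueField (X'.presheaf.stalk (π.base x)))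
            (CotangentSpace (X'.presheaf.stalk (π.base x))) : WithBot ℕ∞) = ((2 : ℕ) : WithBot ℕ∞) := h2
        exact (Nat.cast_injective (R := WithBot ℕ∞) h2').le
      exact BorelCore.stub_borelCore p (π.stalkMap x).hom hι t ht hgen hfin τ τ₁ hτ hcomp hres
    · have hpx : HasNormalSylow p (inertiaSubgroup ρ (π.base x)) := by
        by_contra hc
        exact hx ((hZiff _).mpr hc)
      exact hasNormalSylow_of_le
        (InertiaLe.stub_inertia_le ρs ρ π hequiv x) hpx
  · -- Mumford's cover clause
    exact StableAffineCoverBlowup.stub_stableAffineCoverBlowup q ρ hρ hπ ρs hequiv x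

/-- **In dimension `≤ 2` the crux is its p-closed sub-problem**: WQ for all Galois-type quotient
data with `dim X₁ ≤ 2` follows from PClosedWQNormal for `dim X₁ ≤ 2` alone (the crux + p-closed
inertia + `ρ` faithful + `X₁` normal + `dim X₁ > 0`, bounded by `2`) — Phase 0 being the theorem
`phaseZero_dimLE_two`, fed to the landed bounded glue
`GluedSplitNormal.wildQuotientResolution_dimLE_of_phaseZero_of_pClosedWQNormal`. [folklore] -/
theorem wildQuotientResolution_dimLE_two_of_pClosedWQNormal
    (hWQn : ∀ (p : ℕ) (_ : p.Prime) (k : Type) [Field k] [CharP k p] (X' X₁ : Scheme.{0})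
      (f : X₁ ⟶ Spec (.of k)) (q : X' ⟶ X₁) (G : Type) [Group G] [Finite G] (ρ : G →* Aut X'),
      Function.Injective ρ → IsSeparated f → LocallyOfFiniteType f → QuasiCompact f →
      IsIntegral X₁ → (∀ x : X₁, IsIntegrallyClosed (X₁.presheaf.stalk x)) →
      ¬ topologicalKrullDim X₁ ≤ 0 → IsIntegral X' → Scheme.IsRegular X' → IsFinite q →
      Function.Surjective q.base → (∃ U : X₁.Opens, Dense (U : Set X₁) ∧ Etale (q ∣_ U)) →
      (∀ g : G, (ρ g).hom ≫ q = q) →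
      (∀ x y : X', q.base x = q.base y → ∃ g : G, (ρ g).hom.base x = y) →
      (∀ x : X', HasNormalSylow p (inertiaSubgroup ρ x)) → topologicalKrullDim X₁ ≤ 2 →
      Scheme.HasResolution X₁)
    (p : ℕ) (hp : p.Prime) (k : Type) [Field k] [CharP k p] (X' X₁ : Scheme.{0})
    (f : X₁ ⟶ Spec (.of k)) (q : X' ⟶ X₁) (G : Type) [Group G] [Finite G] (ρ : G →* Aut X')
    (hsep : IsSeparated f) (hft : LocallyOfFiniteType f) (hqc : QuasiCompact f)
    (hX₁ : IsIntegral X₁) (hX' : IsIntegral X') (hreg : Scheme.IsRegular X') (hq : IsFinite q)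
    (hsurj : Function.Surjective q.base)
    (hU : ∃ U : X₁.Opens, Dense (U : Set X₁) ∧ Etale (q ∣_ U))
    (hρ : ∀ g : G, (ρ g).hom ≫ q = q)
    (horb : ∀ x y : X', q.base x = q.base y → ∃ g : G, (ρ g).hom.base x = y)
    (hdim : topologicalKrullDim X₁ ≤ 2) : Scheme.HasResolution X₁ :=
  GluedSplitNormal.wildQuotientResolution_dimLE_of_phaseZero_of_pClosedWQNormal 2
    (fun p hp k _ _ X' X₁ f q G _ _ ρ hfaith hsep hft hqc hX' hreg hq hρ hdimX' => by
      haveI := hsep; haveI := hft; haveI := hqc; haveI := hX'; haveI := hq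
      exact phaseZero_dimLE_two p hp k X' X₁ f q G ρ hfaith hreg hρ hdimX')
    hWQn p hp k X' X₁ f q G ρ hsep hft hqc hX₁ hX' hreg hq hsurj hU hρ horb hdim

end Summit.ResolutionOfSingularities.ResolutionOfSingularities.Theorems.WildQuotientResolution.PhaseZeroDimTwo

end
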